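import Mathlib
import Summits.ValiantsHypothesis.ValiantsHypothesis.Theses.BarrierLever
import Literature.Computability.AlgebraicComplexity.ArithCircuitProofs
import Literature.Computability.AlgebraicComplexity.IMMInVPProofs
import Summits.ValiantsHypothesis.ValiantsHypothesis.Theorems.DivisionGapZeroOneTransferStubSqrtCheap
import Summits.ValiantsHypothesis.ValiantsHypothesis.Theorems.BarrierLeverSingleSizeEquationsReductions

/-!
# Crux `BarrierLever.DefinableEquations` (stmt-ValiantsHypothesis-8745) — LEVEL REDUCTION BY
# DILATION: `SingleSizeEquations → DefinableEquations`, and level `a = 1` always suffices (lead c7)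

`Eq(n, b, a)`: some level-`a` boolean sum (`q ≤ N^a`, `L(H), deg H ≤ N^a`, `N = C(2n,n)`) in the
`N` coefficient variables is nonzero and vanishes at `coeff(f)` for all `f ∈ SmallCircuits ℂ n b`.
The crux is `∃ a ∀ b ∃ n₀ ∀ n ≥ n₀, Eq(n, b, a)`; the support item `SingleSizeEquations`
(stmt-ValiantsHypothesis-8749) swaps the quantifiers, `∀ b ∃ a …` — filed as "too weak for the
lever", which consumes ONE level `a` serving every `b`.

THEOREM (`Dilation.eq_dilate`).  For `1 ≤ A`, `n ≥ 8 (2A)^(b+1) + 2` and `A n ≤ n' < A (n+1)`: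
`Eq(n, b + 4, A) → Eq(n', b, 1)`.  Hence `SingleSizeEquations → DefinableEquations` with `a = 1`
(`definableEquations_of_singleSizeEquations`), `DefinableEquations ↔ SingleSizeEquations`,
`DefinableEquations ↔ ∀ b ∃ n₀ ∀ n ≥ n₀, Eq(n, b, 1)` (`definableEquations_iff_levelOne`), and the
same for the infinitely-often forms the assembly consumes.  The uniformity "`a` must not depend on
`b`" is free: the crux is, for each fixed `b` separately, "eventually in `n`, SOME `poly(N)`-size
boolean-sum equation for size-`n^b` circuits" — Chatterjee–Tengse's open direction 2
(arXiv:2309.07612 §1.3) at `VNP(poly N)`-explicitness (`b ≤ 1`: the tree's rung one; `b = 2` open).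

PROOF.  Lead c5's restrict-and-truncate (`ShiftInN.eq_succ_of_eq`, one variable) works from any
`n' ≥ n` down to `n` (`exists_restrict`: `MvPolynomial.killCompl` along `Fin.castLE`, then `n + 1`
homogeneous components via `SqrtCheap.complexity_homogeneousComponent_le`) at size
`(n+1)(n'+1)(n'^b + n + 2) + (n+1) ≤ n^(b+4)` whenever `n' < A(n+1)`, `n ≥ 8(2A)^(b+1) + 2`
(`restrict_arith`): the size exponent moves by `4` for EVERY dilation factor `A`, while the budget
of the renamed witness obeys `C(2n,n)^A ≤ C(2An, An) ≤ C(2n', n')` (Vandermonde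
super-multiplicativity `centralChoose_mul_le`, `pow_centralChoose_le`, monotonicity), i.e. level
`A` at `n` is level `1` at `n'`.  Given `b`, take `A₀, n₁` from `SingleSizeEquations` at `b + 4`,
`A = max A₀ 1`, and for `n' ≥ A (max n₁ K + 1)` dilate from `n = n' / A`. ∎
Pure bookkeeping over the tree's definitions; no definitions, no named facts.
-/

-- `Summit.ValiantsHypothesis.ValiantsHypothesis.…` repeats a component by the D-0017 layout
-- (single-conjunct summit), which the `dupNamespace` linter flags; the name is mandated.
set_option linter.dupNamespace false

noncomputable section

namespace Summit.ValiantsHypothesis.ValiantsHypothesis.Theorems.BarrierLeverDefinableEquations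

open MvPolynomial
open Literature.Computability.AlgebraicComplexity Literature.Barriers.ValiantsHypothesis
open scoped BigOperators

namespace Dilation

/-! ## §1 Central binomial coefficients are super-multiplicative -/

/-- Vandermonde super-multiplicativity of central binomial coefficients:
`C(2m, m) · C(2n, n) ≤ C(2(m+n), m+n)` (one term of Vandermonde's identity). [folklore] -/
theorem centralChoose_mul_le (m n : ℕ) :
    Nat.choose (2 * m) m * Nat.choose (2 * n) n ≤ Nat.choose (2 * (m + n)) (m + n) := by
  rw [show 2 * (m + n) = 2 * m + 2 * n by ring, Nat.add_choose_eq]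
  have hmem : (m, n) ∈ Finset.HasAntidiagonal.antidiagonal (m + n) := by simp
  exact Finset.single_le_sum (f := fun ij : ℕ × ℕ => (2 * m).choose ij.1 * (2 * n).choose ij.2)
    (fun ij _ => Nat.zero_le _) hmem

/-- `C(2n, n)^A ≤ C(2An, An)`: dilating `n` by a factor `A` raises the coefficient budget
`N = C(2n,n)` to at least its `A`-th power. [folklore] -/
theorem pow_centralChoose_le (n A : ℕ) :
    Nat.choose (2 * n) n ^ A ≤ Nat.choose (2 * (A * n)) (A * n) := by
  induction A with
  | zero => simp
  | succ A ih =>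
    calc Nat.choose (2 * n) n ^ (A + 1)
        = Nat.choose (2 * n) n ^ A * Nat.choose (2 * n) n := pow_succ _ _
      _ ≤ Nat.choose (2 * (A * n)) (A * n) * Nat.choose (2 * n) n := Nat.mul_le_mul_right _ ih
      _ ≤ Nat.choose (2 * (A * n + n)) (A * n + n) := centralChoose_mul_le _ _
      _ = Nat.choose (2 * ((A + 1) * n)) ((A + 1) * n) := by
          rw [show (A + 1) * n = A * n + n by ring]

/-- Central binomial coefficients are monotone: `C(2m, m) ≤ C(2n, n)` for `m ≤ n`. [folklore] -/
theorem centralChoose_mono {m n : ℕ} (h : m ≤ n) :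
    Nat.choose (2 * m) m ≤ Nat.choose (2 * n) n := by
  rw [← Nat.centralBinom_eq_two_mul_choose, ← Nat.centralBinom_eq_two_mul_choose]
  exact Nat.centralBinom_strictMono.monotone h

/-- The budget inequality of the dilation: `C(2n, n)^A ≤ C(2n', n')` for `A n ≤ n'`. [folklore] -/
theorem pow_centralChoose_le_of_le {n A n' : ℕ} (h : A * n ≤ n') :
    Nat.choose (2 * n) n ^ A ≤ Nat.choose (2 * n') n' :=
  (pow_centralChoose_le n A).trans (centralChoose_mono h)

/-! ## §2 Restrict-and-truncate from `n'` variables down to `n ≤ n'` -/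

/-- Arithmetic of the restriction step: for `1 ≤ A`, `8 (2A)^(b+1) + 2 ≤ n` and
`n' + 1 ≤ A (n+1)`, the size of the truncated restriction is within `n^(b+4)`:
`(n+1)((n'+1)(n'^b + n + 2)) + (n+1) ≤ n^(b+4)`. [folklore] -/
theorem restrict_arith {A b n n' : ℕ} (hA : 1 ≤ A) (hK : 8 * (2 * A) ^ (b + 1) + 2 ≤ n)
    (hn' : n' + 1 ≤ A * (n + 1)) :
    (n + 1) * ((n' + 1) * (n' ^ b + n + 2)) + (n + 1) ≤ n ^ (b + 4) := by
  have hn1 : 1 ≤ n := by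
    have : 1 ≤ (2 * A) ^ (b + 1) := Nat.one_le_pow _ _ (by omega)
    omega
  have hM : n' + 1 ≤ 2 * A * n := by
    have hAn : A ≤ A * n := Nat.le_mul_of_pos_right A hn1
    calc n' + 1 ≤ A * (n + 1) := hn'
      _ = A * n + A := by ring
      _ ≤ A * n + A * n := Nat.add_le_add_left hAn _
      _ = 2 * A * n := by ring
  have hM' : n' ≤ 2 * A * n := (Nat.le_succ _).trans hM
  have hpow : n' ^ b ≤ (2 * A * n) ^ b := Nat.pow_le_pow_left hM' b
  have hP : 1 ≤ (2 * A * n) ^ b := Nat.one_le_pow _ _ (by positivity)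
  have h3 : n' ^ b + n + 2 ≤ 4 * n * (2 * A * n) ^ b := by
    calc n' ^ b + n + 2 ≤ (2 * A * n) ^ b + (n + 2) * 1 := by omega
      _ ≤ (2 * A * n) ^ b + (n + 2) * (2 * A * n) ^ b :=
          Nat.add_le_add_left (Nat.mul_le_mul_left _ hP) _
      _ = (n + 3) * (2 * A * n) ^ b := by ring
      _ ≤ (4 * n) * (2 * A * n) ^ b := Nat.mul_le_mul_right _ (by omega)
  have h2n : n + 1 ≤ 2 * n := by omega
  have hn3 : n ≤ n ^ (b + 3) := by
    calc n = n ^ 1 := (pow_one n).symm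
      _ ≤ n ^ (b + 3) := Nat.pow_le_pow_right hn1 (by omega)
  calc (n + 1) * ((n' + 1) * (n' ^ b + n + 2)) + (n + 1)
      ≤ (2 * n) * ((2 * A * n) * (4 * n * (2 * A * n) ^ b)) + 2 * n :=
        Nat.add_le_add (Nat.mul_le_mul h2n (Nat.mul_le_mul hM h3)) h2n
    _ = (8 * (2 * A) ^ (b + 1)) * n ^ (b + 3) + 2 * n := by ring
    _ ≤ (8 * (2 * A) ^ (b + 1)) * n ^ (b + 3) + 2 * n ^ (b + 3) :=
        Nat.add_le_add_left (Nat.mul_le_mul_left _ hn3) _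
    _ = (8 * (2 * A) ^ (b + 1) + 2) * n ^ (b + 3) := by ring
    _ ≤ n * n ^ (b + 3) := Nat.mul_le_mul_right _ hK
    _ = n ^ (b + 4) := by ring

/-- **Restrict-and-truncate** from `n'` variables to the first `n ≤ n'` of them.  For
`f ∈ SmallCircuits ℂ n' b` let `p = f(x₁,…,x_n,0,…,0)` (`MvPolynomial.killCompl` along `Fin.castLE`;
`L(p) ≤ L(f) ≤ n'^b` by `complexity_aeval_le`, `deg p ≤ n'`) and `g = Σ_{k ≤ n} p_k` its truncation
to degree `≤ n` (each homogeneous component costs `≤ (n'+1)(L(p) + n + 2)`,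
`SqrtCheap.complexity_homogeneousComponent_le`).  Then `deg g ≤ n`,
`L(g) ≤ (n+1)((n'+1)(n'^b + n + 2)) + (n+1)`, and `coeff_m(g) = coeff_{ι m}(f)` for every exponent
`m` of degree `≤ n`, where `ι` pads `m` by zero exponents (`coeff_killCompl`). [folklore] -/
theorem exists_restrict {n n' b : ℕ} (hnn' : n ≤ n') (f : MvPolynomial (Fin n') ℂ)
    (hf : f ∈ SmallCircuits ℂ n' b) :
    ∃ g : MvPolynomial (Fin n) ℂ, g.totalDegree ≤ n ∧
      complexity g ≤ (n + 1) * ((n' + 1) * (n' ^ b + n + 2)) + (n + 1) ∧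
      ∀ m : Fin n →₀ ℕ, m.degree ≤ n → coeff m g = coeff (m.mapDomain (Fin.castLE hnn')) f := by
  classical
  obtain ⟨hfdeg, hfc⟩ := hf
  have hinj : Function.Injective (Fin.castLE hnn' : Fin n → Fin n') := Fin.castLE_injective hnn'
  -- `p = f(x₁, …, x_n, 0, …, 0)`
  set p : MvPolynomial (Fin n) ℂ := killCompl hinj f with hp
  have hpc : complexity p ≤ complexity f := by
    rw [hp]
    unfold MvPolynomial.killCompl
    refine (complexity_aeval_le _ _).trans (le_of_eq ?_)
    rw [Finset.sum_eq_zero, add_zero]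
    intro i _
    split_ifs
    · exact complexity_X_holds _
    · have := complexity_C_holds (σ := Fin n) (0 : ℂ)
      rwa [map_zero] at this
  have hpdeg : p.totalDegree ≤ n' := by
    refine Finset.sup_le fun s hs => ?_
    have hs' : s.mapDomain (Fin.castLE hnn') ∈ f.support := by
      rw [MvPolynomial.mem_support_iff] at hs ⊢
      rwa [hp, coeff_killCompl] at hs
    have h1 := le_totalDegree hs'
    rw [Finsupp.sum_mapDomain_index_inj hinj] at h1
    exact h1.trans hfdeg
  -- `g` = truncation of `p` to degree `≤ n`
  set g : MvPolynomial (Fin n) ℂ := ∑ k ∈ Finset.range (n + 1), homogeneousComponent k p with hg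
  refine ⟨g, ?_, ?_, ?_⟩
  · -- degree
    refine totalDegree_finsetSum_le fun k hk => ?_
    have hk' : k ≤ n := by simpa [Finset.mem_range, Nat.lt_succ_iff] using hk
    exact (homogeneousComponent_isHomogeneous k p).totalDegree_le.trans hk'
  · -- size
    have hcomp : ∀ k, complexity (homogeneousComponent k p) ≤ (n' + 1) * (n' ^ b + n + 2) := by
      intro k
      have h1 := Summit.ValiantsHypothesis.ValiantsHypothesis.Theorems.DivisionGapZeroOneTransfer.SqrtCheap.complexity_homogeneousComponent_le
        p hpdeg k
      rw [Fintype.card_fin] at h1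
      refine h1.trans ?_
      have h2 : complexity p + n + 2 ≤ n' ^ b + n + 2 := by
        have := hpc.trans hfc
        omega
      exact Nat.mul_le_mul_left _ h2
    calc complexity g ≤ ∑ k ∈ Finset.range (n + 1), complexity (homogeneousComponent k p) +
          (Finset.range (n + 1)).card := complexity_finset_sum_le _ _
      _ ≤ ∑ k ∈ Finset.range (n + 1), (n' + 1) * (n' ^ b + n + 2) +
          (Finset.range (n + 1)).card :=
        Nat.add_le_add_right (Finset.sum_le_sum fun k _ => hcomp k) _
      _ = (n + 1) * ((n' + 1) * (n' ^ b + n + 2)) + (n + 1) := by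
          rw [Finset.sum_const, Finset.card_range, smul_eq_mul]
  · -- coefficients
    intro m hm
    rw [hg, coeff_sum]
    simp only [coeff_homogeneousComponent]
    rw [Finset.sum_ite_eq (Finset.range (n + 1)) m.degree (fun _ => coeff m p)]
    rw [if_pos (by simpa [Finset.mem_range, Nat.lt_succ_iff] using hm)]
    rw [hp, coeff_killCompl]

/-! ## §3 Level reduction by dilation -/

/-- Monotonicity in the level: a level-`a` witness is a level-`a'` witness, `a ≤ a'`. [folklore] -/
theorem eq_mono_a {a a' b n : ℕ} (haa : a ≤ a')
    (h : ∃ q : ℕ, q ≤ (Nat.choose (2 * n) n) ^ a ∧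
      ∃ H : MvPolynomial (↥(degLEMonomials n) ⊕ Fin q) ℂ,
        complexity H ≤ (Nat.choose (2 * n) n) ^ a ∧ H.totalDegree ≤ (Nat.choose (2 * n) n) ^ a ∧
        boolSum H ≠ 0 ∧
        ∀ f ∈ SmallCircuits ℂ n b, eval (coeffVector (degLEMonomials n) f) (boolSum H) = 0) :
    ∃ q : ℕ, q ≤ (Nat.choose (2 * n) n) ^ a' ∧
      ∃ H : MvPolynomial (↥(degLEMonomials n) ⊕ Fin q) ℂ,
        complexity H ≤ (Nat.choose (2 * n) n) ^ a' ∧ H.totalDegree ≤ (Nat.choose (2 * n) n) ^ a' ∧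
        boolSum H ≠ 0 ∧
        ∀ f ∈ SmallCircuits ℂ n b, eval (coeffVector (degLEMonomials n) f) (boolSum H) = 0 := by
  obtain ⟨q, hq, H, hHc, hHd, hne, hvan⟩ := h
  have hN : (Nat.choose (2 * n) n) ^ a ≤ (Nat.choose (2 * n) n) ^ a' :=
    Nat.pow_le_pow_right (Nat.choose_pos (by omega)) haa
  exact ⟨q, hq.trans hN, H, hHc.trans hN, hHd.trans hN, hne, hvan⟩

/-- **Level reduction by dilation.**  For `1 ≤ A`, `n ≥ 8 (2A)^(b+1) + 2` and
`A n ≤ n' < A (n+1)`: a nonzero level-`A` boolean-sum equation against `SmallCircuits ℂ n (b+4)`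
yields a nonzero level-ONE equation (`q ≤ N'`, `L(H'), deg H' ≤ N' = C(2n',n')`, same `q`) against
`SmallCircuits ℂ n' b` — rename the witness along the zero-padding of exponents
`degLEMonomials n ↪ degLEMonomials n'` (budget `C(2n,n)^A ≤ C(2n',n')`,
`pow_centralChoose_le_of_le`) and feed it the restrict-and-truncate `g` of `exists_restrict`
(`g ∈ SmallCircuits ℂ n (b+4)` by `restrict_arith`). [folklore] -/
theorem eq_dilate {A b n n' : ℕ} (hA : 1 ≤ A) (hK : 8 * (2 * A) ^ (b + 1) + 2 ≤ n)
    (hlo : A * n ≤ n') (hhi : n' + 1 ≤ A * (n + 1))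
    (h : ∃ q : ℕ, q ≤ (Nat.choose (2 * n) n) ^ A ∧
      ∃ H : MvPolynomial (↥(degLEMonomials n) ⊕ Fin q) ℂ,
        complexity H ≤ (Nat.choose (2 * n) n) ^ A ∧ H.totalDegree ≤ (Nat.choose (2 * n) n) ^ A ∧
        boolSum H ≠ 0 ∧
        ∀ f ∈ SmallCircuits ℂ n (b + 4), eval (coeffVector (degLEMonomials n) f) (boolSum H) = 0) :
    ∃ q : ℕ, q ≤ Nat.choose (2 * n') n' ∧
      ∃ H : MvPolynomial (↥(degLEMonomials n') ⊕ Fin q) ℂ,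
        complexity H ≤ Nat.choose (2 * n') n' ∧ H.totalDegree ≤ Nat.choose (2 * n') n' ∧
        boolSum H ≠ 0 ∧
        ∀ f ∈ SmallCircuits ℂ n' b, eval (coeffVector (degLEMonomials n') f) (boolSum H) = 0 := by
  classical
  obtain ⟨q, hq, H, hHc, hHd, hne, hvan⟩ := h
  have hnn' : n ≤ n' := by
    have : 1 * n ≤ A * n := Nat.mul_le_mul_right n hA
    omega
  have hN : (Nat.choose (2 * n) n) ^ A ≤ Nat.choose (2 * n') n' := pow_centralChoose_le_of_le hlo
  -- zero-padding of exponents `Fin n →₀ ℕ` ↪ `Fin n' →₀ ℕ`, degree preserved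
  let ι : ↥(degLEMonomials n) → ↥(degLEMonomials n') := fun m =>
    ⟨(m : Fin n →₀ ℕ).mapDomain (Fin.castLE hnn'), by
      have hm : (m : Fin n →₀ ℕ).degree ≤ n := m.2
      show ((m : Fin n →₀ ℕ).mapDomain (Fin.castLE hnn')).degree ≤ n'
      rw [Finsupp.degree_mapDomain]
      omega⟩
  have hι : Function.Injective ι := by
    intro x y hxy
    apply Subtype.ext
    have h1 := congrArg Subtype.val hxy
    exact Finsupp.mapDomain_injective (Fin.castLE_injective hnn') h1
  refine ⟨q, hq.trans hN, MvPolynomial.rename (Sum.map ι id) H, ?_, ?_, ?_, ?_⟩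
  · exact (complexity_rename_le_holds' _ _).trans (hHc.trans hN)
  · exact (MvPolynomial.totalDegree_rename_le _ _).trans (hHd.trans hN)
  · rw [boolSum_rename_sumMap]
    exact fun hz => hne (MvPolynomial.rename_injective ι hι (by rw [hz, map_zero]))
  · intro f hf
    rw [boolSum_rename_sumMap, MvPolynomial.eval_rename]
    obtain ⟨g, hgdeg, hgc, hcoeff⟩ := exists_restrict hnn' f hf
    have hg : g ∈ SmallCircuits ℂ n (b + 4) := ⟨hgdeg, hgc.trans (restrict_arith hA hK hhi)⟩
    have hcoe : (coeffVector (degLEMonomials n') f) ∘ ι = coeffVector (degLEMonomials n) g := by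
      funext m
      have hm : (m : Fin n →₀ ℕ).degree ≤ n := m.2
      simp only [Function.comp_apply, coeffVector_apply]
      exact (hcoeff _ hm).symm
    rw [hcoe]
    exact hvan g hg

/-- **`∀ b ∃ a` gives level ONE for every `b`.**  If every size exponent `b` has SOME level `a(b)`
of equations for all large `n` (the support item `SingleSizeEquations`, written out), then every
`b` has level-`1` equations for all large `n`: take `A₀, n₁` at `b + 4`, `A = max A₀ 1`,
`K = 8 (2A)^(b+1) + 2`, and for `n' ≥ A (max n₁ K + 1)` dilate from `n = n' / A` (`eq_dilate`).
[folklore] -/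
theorem levelOne_of_singleSize
    (h : ∀ b : ℕ, ∃ a n₀ : ℕ, ∀ n ≥ n₀, ∃ q : ℕ, q ≤ (Nat.choose (2 * n) n) ^ a ∧
      ∃ H : MvPolynomial (↥(degLEMonomials n) ⊕ Fin q) ℂ,
        complexity H ≤ (Nat.choose (2 * n) n) ^ a ∧ H.totalDegree ≤ (Nat.choose (2 * n) n) ^ a ∧
        boolSum H ≠ 0 ∧
        ∀ f ∈ SmallCircuits ℂ n b, eval (coeffVector (degLEMonomials n) f) (boolSum H) = 0) :
    ∀ b : ℕ, ∃ n₀ : ℕ, ∀ n ≥ n₀, ∃ q : ℕ, q ≤ Nat.choose (2 * n) n ∧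
      ∃ H : MvPolynomial (↥(degLEMonomials n) ⊕ Fin q) ℂ,
        complexity H ≤ Nat.choose (2 * n) n ∧ H.totalDegree ≤ Nat.choose (2 * n) n ∧
        boolSum H ≠ 0 ∧
        ∀ f ∈ SmallCircuits ℂ n b, eval (coeffVector (degLEMonomials n) f) (boolSum H) = 0 := by
  intro b
  obtain ⟨A₀, n₁, hA₀⟩ := h (b + 4)
  have hA : 1 ≤ max A₀ 1 := le_max_right _ _
  have hApos : 0 < max A₀ 1 := hA
  refine ⟨max A₀ 1 * (max n₁ (8 * (2 * max A₀ 1) ^ (b + 1) + 2) + 1), fun n' hn' => ?_⟩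
  -- dilate from `n = n' / A`
  have hlo : max A₀ 1 * (n' / max A₀ 1) ≤ n' := Nat.mul_div_le n' (max A₀ 1)
  have hhi : n' + 1 ≤ max A₀ 1 * (n' / max A₀ 1 + 1) :=
    Nat.succ_le_of_lt (Nat.lt_mul_div_succ n' hApos)
  have hnge : max n₁ (8 * (2 * max A₀ 1) ^ (b + 1) + 2) + 1 ≤ n' / max A₀ 1 := by
    calc max n₁ (8 * (2 * max A₀ 1) ^ (b + 1) + 2) + 1
        = max A₀ 1 * (max n₁ (8 * (2 * max A₀ 1) ^ (b + 1) + 2) + 1) / max A₀ 1 := by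
          rw [Nat.mul_div_cancel_left _ hApos]
      _ ≤ n' / max A₀ 1 := Nat.div_le_div_right hn'
  have hn₁ : n₁ ≤ n' / max A₀ 1 := le_trans (le_max_left _ _) (Nat.le_of_succ_le hnge)
  have hK : 8 * (2 * max A₀ 1) ^ (b + 1) + 2 ≤ n' / max A₀ 1 :=
    le_trans (le_max_right _ _) (Nat.le_of_succ_le hnge)
  exact eq_dilate hA hK hlo hhi (eq_mono_a (le_max_left A₀ 1) (hA₀ _ hn₁))

/-- **Infinitely-often version.**  If every `b` has some level `a(b)` of equations for infinitely
many `n`, then every `b` has level-`1` equations for infinitely many `n` (dilate a good `n ≥ K`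
at `b + 4` to `n' = A n`). [folklore] -/
theorem levelOne_io_of_singleSize_io
    (h : ∀ b : ℕ, ∃ a : ℕ, ∀ n₀ : ℕ, ∃ n : ℕ, n₀ ≤ n ∧ ∃ q : ℕ, q ≤ (Nat.choose (2 * n) n) ^ a ∧
      ∃ H : MvPolynomial (↥(degLEMonomials n) ⊕ Fin q) ℂ,
        complexity H ≤ (Nat.choose (2 * n) n) ^ a ∧ H.totalDegree ≤ (Nat.choose (2 * n) n) ^ a ∧
        boolSum H ≠ 0 ∧
        ∀ f ∈ SmallCircuits ℂ n b, eval (coeffVector (degLEMonomials n) f) (boolSum H) = 0) :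
    ∀ b n₀ : ℕ, ∃ n : ℕ, n₀ ≤ n ∧ ∃ q : ℕ, q ≤ Nat.choose (2 * n) n ∧
      ∃ H : MvPolynomial (↥(degLEMonomials n) ⊕ Fin q) ℂ,
        complexity H ≤ Nat.choose (2 * n) n ∧ H.totalDegree ≤ Nat.choose (2 * n) n ∧
        boolSum H ≠ 0 ∧
        ∀ f ∈ SmallCircuits ℂ n b, eval (coeffVector (degLEMonomials n) f) (boolSum H) = 0 := by
  intro b n₀
  obtain ⟨A₀, hA₀⟩ := h (b + 4)
  have hA : 1 ≤ max A₀ 1 := le_max_right _ _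
  obtain ⟨n, hn, hw⟩ := hA₀ (max n₀ (8 * (2 * max A₀ 1) ^ (b + 1) + 2))
  have hn₀ : n₀ ≤ n := le_trans (le_max_left _ _) hn
  have hK : 8 * (2 * max A₀ 1) ^ (b + 1) + 2 ≤ n := le_trans (le_max_right _ _) hn
  refine ⟨max A₀ 1 * n, ?_, ?_⟩
  · have : 1 * n ≤ max A₀ 1 * n := Nat.mul_le_mul_right n hA
    omega
  · have hhi : max A₀ 1 * n + 1 ≤ max A₀ 1 * (n + 1) := by
      rw [Nat.mul_succ]; omega
    exact eq_dilate hA hK le_rfl hhi (eq_mono_a (le_max_left A₀ 1) hw)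

end Dilation

/-! ## §4 The crux and the support item `SingleSizeEquations` are equivalent; level one suffices -/

open Summit.ValiantsHypothesis.ValiantsHypothesis.Theses.BarrierLever

/-- **`SingleSizeEquations → DefinableEquations`** (registered sub-goal, verbatim signature): the
support item stmt-ValiantsHypothesis-8749 (`∀ b ∃ a`) implies the crux stmt-ValiantsHypothesis-8745
(`∃ a ∀ b`), with the uniform level `a = 1` (`Dilation.levelOne_of_singleSize`). [folklore] -/
theorem definableEquations_of_singleSizeEquations :
    Summit.ValiantsHypothesis.ValiantsHypothesis.Theses.BarrierLever.SingleSizeEquations → Summit.ValiantsHypothesis.ValiantsHypothesis.Theses.BarrierLever.DefinableEquations := by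
  intro h
  refine ⟨1, fun b => ?_⟩
  simp only [pow_one]
  exact Dilation.levelOne_of_singleSize h b

/-- **The crux is equivalent to the support item**: `DefinableEquations ↔ SingleSizeEquations`
(`→`: swap the quantifiers, `SingleSizeEquations.singleSizeEquations_of_definableEquations`;
`←`: level reduction by dilation). [folklore] -/
theorem definableEquations_iff_singleSizeEquations :
    DefinableEquations ↔ SingleSizeEquations :=
  ⟨Summit.ValiantsHypothesis.ValiantsHypothesis.Theorems.SingleSizeEquations.singleSizeEquations_of_definableEquations,
    definableEquations_of_singleSizeEquations⟩

/-- **Level one suffices**: `DefinableEquations` holds iff for every `b`, for all large `n`, there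
is a nonzero boolean-sum equation against `SmallCircuits ℂ n b` with `q ≤ N`, `L(H) ≤ N`,
`deg H ≤ N`, `N = C(2n,n)` — the whole level hierarchy `N^a` collapses to `a = 1`. [folklore] -/
theorem definableEquations_iff_levelOne :
    DefinableEquations ↔
      ∀ b : ℕ, ∃ n₀ : ℕ, ∀ n ≥ n₀, ∃ q : ℕ, q ≤ Nat.choose (2 * n) n ∧
        ∃ H : MvPolynomial (↥(degLEMonomials n) ⊕ Fin q) ℂ,
          complexity H ≤ Nat.choose (2 * n) n ∧ H.totalDegree ≤ Nat.choose (2 * n) n ∧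
          boolSum H ≠ 0 ∧
          ∀ f ∈ SmallCircuits ℂ n b, eval (coeffVector (degLEMonomials n) f) (boolSum H) = 0 := by
  constructor
  · intro h
    exact Dilation.levelOne_of_singleSize
      (Summit.ValiantsHypothesis.ValiantsHypothesis.Theorems.SingleSizeEquations.singleSizeEquations_of_definableEquations h)
  · intro h
    refine ⟨1, fun b => ?_⟩
    simp only [pow_one]
    exact h b

/-- **Infinitely-often forms.**  The form of the crux the assembly consumes (`DefEq_io`: one level
`a`, every `b`, infinitely often in `n`) is equivalent to its `∀ b ∃ a` version and to its
level-one version. [folklore] -/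
theorem definableEquations_io_iff_singleSize_io :
    (∃ a : ℕ, ∀ b n₀ : ℕ, ∃ n : ℕ, n₀ ≤ n ∧ ∃ q : ℕ, q ≤ (Nat.choose (2 * n) n) ^ a ∧
      ∃ H : MvPolynomial (↥(degLEMonomials n) ⊕ Fin q) ℂ,
        complexity H ≤ (Nat.choose (2 * n) n) ^ a ∧ H.totalDegree ≤ (Nat.choose (2 * n) n) ^ a ∧
        boolSum H ≠ 0 ∧
        ∀ f ∈ SmallCircuits ℂ n b, eval (coeffVector (degLEMonomials n) f) (boolSum H) = 0) ↔
    (∀ b : ℕ, ∃ a : ℕ, ∀ n₀ : ℕ, ∃ n : ℕ, n₀ ≤ n ∧ ∃ q : ℕ, q ≤ (Nat.choose (2 * n) n) ^ a ∧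
      ∃ H : MvPolynomial (↥(degLEMonomials n) ⊕ Fin q) ℂ,
        complexity H ≤ (Nat.choose (2 * n) n) ^ a ∧ H.totalDegree ≤ (Nat.choose (2 * n) n) ^ a ∧
        boolSum H ≠ 0 ∧
        ∀ f ∈ SmallCircuits ℂ n b, eval (coeffVector (degLEMonomials n) f) (boolSum H) = 0) := by
  constructor
  · rintro ⟨a, ha⟩ b
    exact ⟨a, ha b⟩
  · intro h
    refine ⟨1, fun b n₀ => ?_⟩
    simp only [pow_one]
    exact Dilation.levelOne_io_of_singleSize_io h b n₀

end Summit.ValiantsHypothesis.ValiantsHypothesis.Theorems.BarrierLeverDefinableEquations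

end
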